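import Summits.HodgeConjecture.HodgeCM.PerL34.ArchCFock_1

/-! PORT of `HodgeCM/PerL34/ArchCFock.lean` (HodgeCMPerL run 82) — part 2: continuation of `Summits.HodgeConjecture.HodgeCM.PerL34.ArchCFock_1` (split at a top-level declaration boundary by port_pkg.py; scope re-opened below; declarations unchanged). -/

-- port_pkg: scope re-opened for this part (file-level context, then the namespace/section stack open at the cut)
set_option autoImplicit false
set_option linter.unusedSectionVars false
noncomputable section
open Function
open scoped TensorProduct
namespace HodgeCM
namespace PerL34
namespace Fock
namespace FockPlaces
variable (pl : FockPlaces)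
/-- The same in the verbatim field format of `ArchCDatum.gen`. -/
theorem gen_format : ∀ N : Submodule ℂ pl.F, pl.φ₀ ∈ N → (∀ k, ∀ φ ∈ N, pl.X k φ ∈ N) → N = ⊤ :=
  pl.isGeneratedBy

/-- **φ⁰ is a joint T(L₀⊗ℝ)-eigenvector with the product character — KERNEL** (from the local `eigen` fields). -/
theorem ωT_φ₀ (t : pl.Tg) : pl.ωT t pl.φ₀ = pl.χ t • pl.φ₀ :=
  map_tprod_eq_prod_smul (fun b => (pl.loc b).ω) (fun b => (pl.loc b).χ) (fun b => (pl.loc b).φ)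
    (fun b => (pl.loc b).eigen) t

end FockPlaces

end Fock

/-! ## §4  The bridge record and `ArchCDatum` from it -/

namespace ArchC

open HodgeCM.Prior.Perl34File HodgeCM.Prior.Perl34File.Perl34

section Bridge

variable {H HG CG G SK SigIdx SigIdxG : Type*}
variable [NormedAddCommGroup H] [InnerProductSpace ℂ H] [CompleteSpace H]
variable [NormedAddCommGroup HG] [InnerProductSpace ℂ HG] [CompleteSpace HG]
variable [NormedAddCommGroup CG] [NormedSpace ℂ CG]
variable [Group G] [TopologicalSpace G] [TopologicalSpace SK]

/-- **Seam S4 bridge** = pv06's `ArchCDatum C D P` with its archimedean layer FIXED to the joint Fock objects of a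
`Fock.FockPlaces` (`F := ⊗_b (loc b).M`, `ιX`, `X` = slots, `φ₀ := ⊗_b φ⁰_b`, `Tg := ∏_b T_b`, `ωT` factorwise) and
its two `[NODE N28]` fields `gen`, `φ₀_eigen` REMOVED (they are theorems: `toArchCDatum`).  Every remaining field
is carried verbatim from `ArchCDatum` with pv06's label and source; the one new field `w_loc` is [NODE N26 /
DICTIONARY].  No field restates `H_occ` / `Open_occ`. -/
structure FockArchBridge (C : IsolationCore H HG CG G SK SigIdx SigIdxG) (D : TorusData C)
    (P : C4a.PointedCore C) where
  /-- [SETUP D5 + NODE N28 local (kernel via `LocalFock.ofE/ofM/ofIcol`)] the real places with their κ_b-parts. -/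
  pl : Fock.FockPlaces
  /-- [SETUP D4] T(L₀⊗ℝ) = ∏_b T_b ⊂ U(W)(L₀⊗ℝ) ⊂ U(W)(𝔸) = `G`. -/
  ιT : pl.Tg →* G
  /-- [SETUP D4] the archimedean type w = (e_b(Ψ₁), e_b(Ψ₂))_b as a character of T(L₀⊗ℝ) (ll. 387–388, 485–486). -/
  w : pl.Tg →* ℂ
  /-- [SETUP D4] w is unitary. -/
  w_norm : ∀ t, ‖w t‖ = 1
  /-- [NODE N26 / DICTIONARY] (PerL §4.1 ll. 472–478; pv01 `ArchBookkeeping.N26_holds`): the integers e_b(Ψ_i) are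
  DEFINED by the action of U(W_{i,b}) on φ⁰_{i,b}, i.e. the joint character of T(L₀⊗ℝ) on φ⁰ = ⊗_b φ⁰_b (the product
  `pl.χ` of the local vacuum × polynomial characters, KERNEL-computed in the explicit models: `1`-lines carry the
  vacuum character, `det(z)` carries `vac · det`) IS −w = w⁻¹ (l. 485–486 "acts by the character −w_b"). -/
  w_loc : ∀ t : pl.Tg, pl.χ t = (w t)⁻¹
  /-- [SETUP D4] index of the fixed data at the other places (l. 516): Φ_f ∈ 𝒮((V₃⊗W)(𝔸_f)). -/
  FinIdx : Type
  /-- [SETUP D4] the pure tensor φ ⊗ Φ_f ∈ 𝒮^κ for φ ∈ 𝓕^κ_∞. -/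
  ins : FinIdx → pl.F → SK
  /-- [SETUP D7] the smooth (Gårding) vectors of σ̂_i (Getz–Hahn GTM 300, Prop. 4.2.3, p. 76). -/
  Sm : SigIdx → Set H
  /-- [SETUP D7] the derived action dR(X_k) on smooth vectors (Getz–Hahn Lemma 4.2.2). -/
  Y : pl.ιX → H → H
  /-- [SETUP D4] Φ ↦ 𝒯_Φ is linear: additivity along `ins f`. -/
  ins_add : ∀ (f : FinIdx) (φ ψ : pl.F), C.TΦc (ins f (φ + ψ)) = C.TΦc (ins f φ) + C.TΦc (ins f ψ)
  /-- [SETUP D4] Φ ↦ 𝒯_Φ is linear: homogeneity along `ins f`. -/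
  ins_smul : ∀ (f : FinIdx) (c : ℂ) (φ : pl.F), C.TΦc (ins f (c • φ)) = c • C.TΦc (ins f φ)
  /-- [SETUP D4] ω = ⊗'_v ω_v: ω(t)(φ ⊗ Φ_f) = (ω_∞(t)φ) ⊗ Φ_f with ω_∞|_{T} = ⊗_b ω_{W,b}|_{T_b} (= `pl.ωT`). -/
  omg_ins : ∀ (f : FinIdx) (t : pl.Tg) (φ : pl.F), C.omg (ιT t) (ins f φ) = ins f (pl.ωT t φ)
  /-- [NODE N21] (l. 382–383, used at l. 513–514; pv05 `KernelOperator.opT_comp_eq` over the L²-kernel shell):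
  𝒯_{ω(h)Φ}(R(h)v) = 𝒯_Φ(v). -/
  invariance : ∀ (h : G) (Φ : SK) (v : H), C.TΦc (C.omg h Φ) (C.R h v) = C.TΦc Φ v
  /-- [SETUP D4] "Restricting to pure tensors" (l. 514–515): a non-zero point value 𝒯_Φ(v)(g) is detected by a pure
  tensor φ ⊗ Φ_f, φ ∈ 𝓕^κ_∞ (density of ⊗_b 𝓕^{κ_b}_b ⊗ 𝒮(𝔸_f) in 𝒮^κ + continuity in Φ, l. 341–343, 356–358). -/
  pure_detect : ∀ (Φ : SK) (p : P.Pt) (v : H), P.evalPt p (C.TΦc Φ v) ≠ 0 →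
    ∃ (f : FinIdx) (φ : pl.F), P.evalPt p (C.TΦc (ins f φ) v) ≠ 0
  /-- [SETUP D7] smooth vectors of σ̂_i lie in σ̂_i. -/
  Sm_sub : ∀ i, Sm i ⊆ (C.hatσ i : Set H)
  /-- [SETUP D7] smooth vectors are dense in σ̂_i (Getz–Hahn Prop. 4.2.3). -/
  Sm_dense : ∀ i, (C.hatσ i : Set H) ⊆ closure (Sm i)
  /-- [SETUP D7] smooth vectors are stable under dR(𝔲(W_∞)) (Getz–Hahn Lemma 4.2.2). -/
  Y_mem : ∀ (k : pl.ιX) (i : SigIdx), ∀ v ∈ Sm i, Y k v ∈ Sm i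
  /-- [SETUP D4/D7] infinitesimal invariance ⟨Xφ,v⟩ = −⟨φ,Xv⟩ (l. 517), for the slot operators `pl.X`. -/
  inf_invariance : ∀ (f : FinIdx) (p : P.Pt) (k : pl.ιX) (φ : pl.F) (i : SigIdx), ∀ v ∈ Sm i,
    P.evalPt p (C.TΦc (ins f (pl.X k φ)) v) = - P.evalPt p (C.TΦc (ins f φ) (Y k v))
  /-- [DEFINITIONAL] the meaning of the bare frozen predicate `TorusData.wOccurs` (ll. 387–390). -/
  wOccurs_of_eigenvector : ∀ i : SigIdx,
    (∃ y ∈ C.hatσ i, y ≠ 0 ∧ ∀ t : pl.Tg, C.R (ιT t) y = w t • y) → D.wOccurs i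

namespace FockArchBridge

variable {C : IsolationCore H HG CG G SK SigIdx SigIdxG} {D : TorusData C} {P : C4a.PointedCore C}

/-- **`ArchCDatum.ofFock`**: the Lemma-4.1(c) datum of pv06 from the bridge, with BOTH `[NODE N28]` fields PROVED
(`Fock.FockPlaces.isGeneratedBy`, `Fock.FockPlaces.ωT_φ₀` + the N26 dictionary line `w_loc`). -/
def toArchCDatum (B : FockArchBridge C D P) : ArchCDatum C D P where
  F := B.pl.F
  ιX := B.pl.ιX
  X := B.pl.X
  Tg := B.pl.Tg
  ιT := B.ιT
  w := B.w
  w_norm := B.w_norm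
  ωT := B.pl.ωT
  FinIdx := B.FinIdx
  ins := B.ins
  φ₀ := B.pl.φ₀
  Sm := B.Sm
  Y := B.Y
  ins_add := B.ins_add
  ins_smul := B.ins_smul
  omg_ins := B.omg_ins
  invariance := B.invariance
  pure_detect := B.pure_detect
  Sm_sub := B.Sm_sub
  Sm_dense := B.Sm_dense
  Y_mem := B.Y_mem
  inf_invariance := B.inf_invariance
  gen := B.pl.gen_format
  φ₀_eigen := fun t => by rw [B.pl.ωT_φ₀, B.w_loc]
  wOccurs_of_eigenvector := B.wOccurs_of_eigenvector

/-- Read-back: the datum's Fock layer IS the joint Fock κ-part. -/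
theorem toArchCDatum_F (B : FockArchBridge C D P) : B.toArchCDatum.F = B.pl.F := rfl

/-- (Ported verbatim from the HodgeCMPerL package; no docstring in the source.) -/
theorem toArchCDatum_φ₀ (B : FockArchBridge C D P) : B.toArchCDatum.φ₀ = B.pl.φ₀ := rfl

/-- **Lemma 4.1(c) over the bridge** (pv06 `ArchCDatum.H_occ`, N28 discharged). -/
theorem H_occ (B : FockArchBridge C D P) :
    ∀ (Φ : SK) (i : SigIdx), (∃ v ∈ C.hatσ i, C.TΦ Φ v ≠ 0) → D.wOccurs i :=
  B.toArchCDatum.H_occ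

end FockArchBridge

end Bridge

end ArchC

/-! ### The model-level corollaries BY NAME -/

section Model

open HodgeCM.Prior.Perl34File HodgeCM.Prior.Perl34File.Perl34 HodgeCM.PerL34.ArchC

variable {U : Universe}

/-- **`Open_occ` (prl1 A10 = Thm 3.7's (†)) from Fock bridges in every good context** — pv06's
`Open_occ_of_archC` with the two N28 fields of each `ArchCDatum` DISCHARGED by the Fock tensor product. -/
theorem Open_occ_of_fockBridges (T : U.ThetaModel)
    (Pc : ∀ {L : CMField} {ι₁ : L →+* ℂ} (V : HermSpace3 L ι₁) (c : SeesawCtx L),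
      C4a.PointedCore (T.core V c))
    (B12 : ∀ {L : CMField} {ι₁ : L →+* ℂ} (V : HermSpace3 L ι₁) (c : SeesawCtx L),
      T.GoodCtx ι₁ c → Nonempty (FockArchBridge (T.core V c) (T.t12 V c) (Pc V c)))
    (B34 : ∀ {L : CMField} {ι₁ : L →+* ℂ} (V : HermSpace3 L ι₁) (c : SeesawCtx L),
      T.GoodCtx ι₁ c → Nonempty (FockArchBridge (T.core V c) (T.t34 V c) (Pc V c))) :
    T.Open_occ :=
  T.Open_occ_of_archC Pc (fun V c hc => (B12 V c hc).map FockArchBridge.toArchCDatum)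
    (fun V c hc => (B34 V c hc).map FockArchBridge.toArchCDatum)

/-- **N29 (= `Open_occ`) BY NAME from Fock bridges** (carver `N29_occ` / `AssemblyLeaves.N29_occ_of_archC`): the
binders `A12/A34` of `perL_of_leaves'` / `perL_of_dictLeaves` may be fed `Nonempty (FockArchBridge …)`. -/
theorem N29_occ_of_fockBridges (T : U.ThetaModel)
    (Pc : ∀ {L : CMField} {ι₁ : L →+* ℂ} (V : HermSpace3 L ι₁) (c : SeesawCtx L),
      C4a.PointedCore (T.core V c))
    (B12 : ∀ {L : CMField} {ι₁ : L →+* ℂ} (V : HermSpace3 L ι₁) (c : SeesawCtx L),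
      T.GoodCtx ι₁ c → Nonempty (FockArchBridge (T.core V c) (T.t12 V c) (Pc V c)))
    (B34 : ∀ {L : CMField} {ι₁ : L →+* ℂ} (V : HermSpace3 L ι₁) (c : SeesawCtx L),
      T.GoodCtx ι₁ c → Nonempty (FockArchBridge (T.core V c) (T.t34 V c) (Pc V c))) :
    N29_occ T :=
  (N29_iff T).mpr (Open_occ_of_fockBridges T Pc B12 B34)

end Model

end PerL34
end HodgeCM

end
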